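import Summits.Ventures.PercRepro.HyperplaneKeyBasesSix
import Summits.Ventures.PercRepro.HyperplaneKeyBasesSeven

/-!
# PercRepro — THE SHARP HYPERPLANE KEY, UNIFORM IN THE RANK `p` AT SLOPE `2`: ONE THEOREM PER LEVEL FOR EVERY ROW (p1, gen 44;
an S3 / S4 feeder — p8 owns SUBCLAIM-S3, p9 SUBCLAIM-S4; no window claim here)

The per-row keys of `HyperplaneKeyBasesSix` / `HyperplaneKeyBasesSeven` certify `(Φ(p,q) + 1)·A(n) ≤ 2^{⌊n/2⌋}` at two
base values of `n` for each `p` separately. Here the `p`-dependence is removed exactly: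

* `(Φ(p,q) + 1)·C(p+q, p) = Σ_{q<u<p} C(p+q, u) + C(p+q, p) ≤ 2^{p+q}` (`phiK_add_one_mul_choose_le`, no loss);
* `C(p+q, p)·q! ≥ (p+1)^q` (`pow_le_choose_mul_factorial`, the falling factorial);
* the cap `A(n) = Σ_{j≤q} C(n,j)·w_j ≤ W·n^q` with `W = Σ_{j≤q} w_j/j!` (`sum_choose_mul_le_pow`);
* on `n = 2p + m` with `p ≥ p₀` the ratio `n/(p+1) ≤ (2(p₀+1) + m)/(p₀+1)` is monotone in `p` (`div_le_of_ge`).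

Hence `(Φ+1)·A(n) ≤ 2^p · G(m)` with the ONE-VARIABLE `G(m) = 2^q·q!·W·((2(p₀+1)+m)/(p₀+1))^q`, and `G(m) ≤ 2^{⌊m/2⌋}` for
every `m ≥ m₀` follows from the two base values `m₀`, `m₀ + 1` and the doubling `G(m+2) ≤ 2·G(m)` (`(x+2)^q ≤ 2x^q` for
`x ≥ 4q`, from `(1+t)^q ≤ 1 + 2qt` for `2qt ≤ 1`). So **`ThmN.RLS M p q` for every `e`-free `M` of rank `p ≥ p₀` on
`n ≥ 2p + m₀` points** (`rls_of_hyperplane_key_uniform_weighted`), and with the flat-by-flat weights of the tree: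

* level `5`: `p ≥ 8`, `n ≥ 2p + 62` (`c025_core_five_hyperplane_key_uniform`);
* level `6`: `p ≥ 9`, `n ≥ 2p + 92` (`c025_core_six_hyperplane_key_uniform`; the per-row keys: `102 … 120` at `p = 9 … 21`);
* level `7`: `p ≥ 10`, `n ≥ 2p + 170` (`c025_core_seven_hyperplane_key_uniform`; per-row `182 … 196` at `p = 10 … 21`, and the
  exact per-row threshold would be `344` at `p = 104` against `378` here).

The `g42` uniform key (`HyperplaneKeyUniform`, the crude weights `2^{2^j−1−j}` and `Φ ≤ 2^{p+q}` without the binomial) has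
slope `4`: `n ≥ 4(p + 2q + 2^q + 1)`, i.e. `4p + 572` at level `7`. Coloops are not excluded; nothing is claimed about any cell
below `2p + m₀`.
Axioms: standard.
-/

open scoped Matroid

namespace PercRepro

namespace HypKey

open Set

variable {α : Type}

/-- **`(Φ(p,q) + 1)·C(p+q, p) ≤ 2^{p+q}`**: `Σ_{q<u<p} C(p+q, u) + C(p+q, p)` is a sub-sum of `Σ_{u ≤ p+q} C(p+q, u) = 2^{p+q}`. -/
theorem phiK_add_one_mul_choose_le (p q : ℕ) :
    (phiK p q + 1) * ((p + q).choose p : ℚ) ≤ (2 : ℚ) ^ (p + q) := by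
  have hC : (0 : ℚ) < ((p + q).choose p : ℚ) := by
    exact_mod_cast Nat.choose_pos (by omega)
  unfold phiK
  rw [div_add_one hC.ne', div_mul_cancel₀ _ hC.ne']
  have hsub : insert p (Finset.Ioo q p) ⊆ Finset.range (p + q + 1) := by
    intro u hu
    rw [Finset.mem_insert, Finset.mem_Ioo] at hu
    rw [Finset.mem_range]
    omega
  have hnot : p ∉ Finset.Ioo q p := by simp
  have h1 : ∑ u ∈ insert p (Finset.Ioo q p), ((p + q).choose u : ℚ) ≤
      ∑ u ∈ Finset.range (p + q + 1), ((p + q).choose u : ℚ) :=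
    Finset.sum_le_sum_of_subset_of_nonneg hsub (fun _ _ _ => Nat.cast_nonneg _)
  rw [Finset.sum_insert hnot] at h1
  have h2 : ∑ u ∈ Finset.range (p + q + 1), ((p + q).choose u : ℚ) = (2 : ℚ) ^ (p + q) := by
    exact_mod_cast Nat.sum_range_choose (p + q)
  linarith

/-- **`(p+1)^q ≤ C(p+q, p)·q!`** — the falling factorial `(p+q)(p+q−1)⋯(p+1) = C(p+q, q)·q!` is `≥ (p+1)^q`. -/
theorem pow_le_choose_mul_factorial (p q : ℕ) : (p + 1) ^ q ≤ (p + q).choose p * q.factorial := by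
  have h1 := Nat.pow_sub_le_descFactorial (p + q) q
  have h2 : p + q + 1 - q = p + 1 := by omega
  rw [h2, Nat.descFactorial_eq_factorial_mul_choose, ← Nat.choose_symm_add, mul_comm] at h1
  exact h1

/-- **The cap is at most `W·n^q`**: `Σ_{j ≤ q} C(n, j)·w_j ≤ (Σ_{j ≤ q} w_j / j!)·n^q` for `n ≥ 1`. -/
theorem sum_choose_mul_le_pow (q n : ℕ) (hn : 1 ≤ n) (w : ℕ → ℕ) :
    ∑ j ∈ Finset.range (q + 1), (n.choose j : ℚ) * (w j : ℚ) ≤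
      (∑ j ∈ Finset.range (q + 1), (w j : ℚ) / (j.factorial : ℚ)) * (n : ℚ) ^ q := by
  rw [Finset.sum_mul]
  refine Finset.sum_le_sum (fun j hj => ?_)
  have hjq : j ≤ q := by
    have := Finset.mem_range.1 hj
    omega
  have h1 : (n.choose j : ℚ) ≤ ((n : ℚ) ^ j) / (j.factorial : ℚ) := by
    have := Nat.choose_le_pow_div (α := ℚ) j n
    simpa using this
  have hn1 : (1 : ℚ) ≤ (n : ℚ) := by exact_mod_cast hn
  have h2 : (n : ℚ) ^ j ≤ (n : ℚ) ^ q := pow_le_pow_right₀ hn1 hjq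
  have hw : (0 : ℚ) ≤ (w j : ℚ) := Nat.cast_nonneg _
  have hf : (0 : ℚ) < (j.factorial : ℚ) := by exact_mod_cast Nat.factorial_pos j
  calc (n.choose j : ℚ) * (w j : ℚ) ≤ ((n : ℚ) ^ j / (j.factorial : ℚ)) * (w j : ℚ) :=
        mul_le_mul_of_nonneg_right h1 hw
    _ ≤ ((n : ℚ) ^ q / (j.factorial : ℚ)) * (w j : ℚ) := by gcongr
    _ = (w j : ℚ) / (j.factorial : ℚ) * (n : ℚ) ^ q := by ring

/-- `(1 + t)^q ≤ 1 + 2qt` for `0 ≤ t` and `2qt ≤ 1`. -/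
theorem one_add_pow_le_one_add_two_mul (q : ℕ) (t : ℚ) (ht : 0 ≤ t) (hqt : 2 * (q : ℚ) * t ≤ 1) :
    (1 + t) ^ q ≤ 1 + 2 * (q : ℚ) * t := by
  induction q with
  | zero => simp
  | succ q ih =>
    have hq1 : ((q + 1 : ℕ) : ℚ) = (q : ℚ) + 1 := by push_cast; ring
    rw [hq1] at hqt ⊢
    have hqt' : 2 * (q : ℚ) * t ≤ 1 := by nlinarith
    have ih' := ih hqt'
    rw [pow_succ]
    have h1t : 0 ≤ 1 + t := by linarith
    calc (1 + t) ^ q * (1 + t) ≤ (1 + 2 * (q : ℚ) * t) * (1 + t) := mul_le_mul_of_nonneg_right ih' h1t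
      _ = 1 + 2 * ((q : ℚ) + 1) * t - (t - 2 * (q : ℚ) * t * t) := by ring
      _ ≤ 1 + 2 * ((q : ℚ) + 1) * t := by nlinarith

/-- `(x + 2)^q ≤ 2·x^q` for `4q ≤ x`, `0 < x` (in `ℚ`). -/
theorem pow_add_two_le_two_mul_pow (q : ℕ) (x : ℚ) (hx : 4 * (q : ℚ) ≤ x) (hx0 : 0 < x) :
    (x + 2) ^ q ≤ 2 * x ^ q := by
  have ht : 0 ≤ 2 / x := by positivity
  have hqt : 2 * (q : ℚ) * (2 / x) ≤ 1 := by
    have e : 2 * (q : ℚ) * (2 / x) = 4 * (q : ℚ) / x := by ring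
    rw [e, div_le_one hx0]
    exact hx
  have h := one_add_pow_le_one_add_two_mul q (2 / x) ht hqt
  have hx2 : x + 2 = x * (1 + 2 / x) := by field_simp
  rw [hx2, mul_pow]
  have hxq : 0 ≤ x ^ q := by positivity
  calc x ^ q * (1 + 2 / x) ^ q ≤ x ^ q * (1 + 2 * (q : ℚ) * (2 / x)) := by gcongr
    _ ≤ x ^ q * 2 := by nlinarith
    _ = 2 * x ^ q := by ring

/-- On `n = 2p + m` with `p₀ ≤ p` and `2 ≤ m`: `n/(p+1) ≤ (2(p₀+1) + m)/(p₀+1)`. -/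
theorem div_le_of_ge (p₀ p m : ℕ) (hp : p₀ ≤ p) :
    ((2 * p + m : ℕ) : ℚ) / ((p + 1 : ℕ) : ℚ) ≤ ((2 * (p₀ + 1) + m : ℕ) : ℚ) / ((p₀ + 1 : ℕ) : ℚ) := by
  have h1 : (0 : ℚ) < ((p + 1 : ℕ) : ℚ) := by positivity
  have h2 : (0 : ℚ) < ((p₀ + 1 : ℕ) : ℚ) := by positivity
  rw [div_le_div_iff₀ h1 h2]
  have h3 : (2 * p + m) * (p₀ + 1) ≤ (2 * (p₀ + 1) + m) * (p + 1) := by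
    have := Nat.mul_le_mul_left m hp
    nlinarith
  exact_mod_cast h3

/-- **THE SHARP KEY, UNIFORM IN `p`.** `e`-free, `ρ(E) = p ≥ p₀`, a cap `#{ρ ≤ q} ≤ Σ_{j≤q} C(n, j)·w_j`, `n ≥ 2p + m₀`,
`4q ≤ 2(p₀+1) + m₀`, and the one-variable key `G(m) = 2^q·q!·(Σ_{j≤q} w_j/j!)·((2(p₀+1)+m)/(p₀+1))^q ≤ 2^{⌊m/2⌋}` at
`m = m₀` and `m = m₀ + 1` give `ThmN.RLS M p q`. -/
theorem rls_of_hyperplane_key_uniform_weighted (M : Matroid α) [M.Finite] (p q : ℕ) (hR : M.eRank = (p : ℕ∞))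
    (hfree : ∀ e ∈ M.E, ∃ A ⊆ M.E \ {e}, e ∉ M.closure A ∧ e ∉ M.closure ((M.E \ {e}) \ A))
    (w : ℕ → ℕ)
    (hcount : {X : Set α | X ⊆ M.E ∧ M.eRk X ≤ (q : ℕ∞)}.ncard ≤ ∑ j ∈ Finset.range (q + 1), M.E.ncard.choose j * w j)
    (hq : 1 ≤ q) (p₀ m₀ : ℕ) (hp : p₀ ≤ p) (h4 : 4 * q ≤ 2 * (p₀ + 1) + m₀) (hn : 2 * p + m₀ ≤ M.E.ncard)
    (h0 : (2 : ℚ) ^ q * (q.factorial : ℚ) * (∑ j ∈ Finset.range (q + 1), (w j : ℚ) / (j.factorial : ℚ)) *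
        (((2 * (p₀ + 1) + m₀ : ℕ) : ℚ) / ((p₀ + 1 : ℕ) : ℚ)) ^ q ≤ (2 : ℚ) ^ (m₀ / 2))
    (h1 : (2 : ℚ) ^ q * (q.factorial : ℚ) * (∑ j ∈ Finset.range (q + 1), (w j : ℚ) / (j.factorial : ℚ)) *
        (((2 * (p₀ + 1) + (m₀ + 1) : ℕ) : ℚ) / ((p₀ + 1 : ℕ) : ℚ)) ^ q ≤ (2 : ℚ) ^ ((m₀ + 1) / 2)) :
    ThmN.RLS M p q := by
  set n := M.E.ncard with hn_def
  set m := n - 2 * p with hm_def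
  have hnm : n = 2 * p + m := by omega
  have hm₀ : m₀ ≤ m := by omega
  set W : ℚ := ∑ j ∈ Finset.range (q + 1), (w j : ℚ) / (j.factorial : ℚ) with hW
  have hWnn : 0 ≤ W := Finset.sum_nonneg (fun j _ => by positivity)
  -- the one-variable key
  set G : ℕ → ℚ := fun k => (2 : ℚ) ^ q * (q.factorial : ℚ) * W *
    (((2 * (p₀ + 1) + k : ℕ) : ℚ) / ((p₀ + 1 : ℕ) : ℚ)) ^ q with hG
  have hGstep : ∀ k, m₀ ≤ k → G (k + 2) ≤ 2 * G k := by
    intro k hk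
    simp only [hG]
    have hp0 : (0 : ℚ) < ((p₀ + 1 : ℕ) : ℚ) := by positivity
    have hy0 : (0 : ℚ) < ((2 * (p₀ + 1) + k : ℕ) : ℚ) := by positivity
    have hy : 4 * (q : ℚ) ≤ ((2 * (p₀ + 1) + k : ℕ) : ℚ) := by
      have h5 : 4 * q ≤ 2 * (p₀ + 1) + k := by omega
      exact_mod_cast h5
    have hdbl := pow_add_two_le_two_mul_pow q _ hy hy0
    have hsplit : ((2 * (p₀ + 1) + (k + 2) : ℕ) : ℚ) = ((2 * (p₀ + 1) + k : ℕ) : ℚ) + 2 := by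
      push_cast
      ring
    rw [hsplit, div_pow, div_pow]
    have hc : 0 ≤ (2 : ℚ) ^ q * (q.factorial : ℚ) * W := by positivity
    have hpq : 0 < ((p₀ + 1 : ℕ) : ℚ) ^ q := by positivity
    calc (2 : ℚ) ^ q * (q.factorial : ℚ) * W *
          ((((2 * (p₀ + 1) + k : ℕ) : ℚ) + 2) ^ q / ((p₀ + 1 : ℕ) : ℚ) ^ q)
        ≤ (2 : ℚ) ^ q * (q.factorial : ℚ) * W *
          ((2 * ((2 * (p₀ + 1) + k : ℕ) : ℚ) ^ q) / ((p₀ + 1 : ℕ) : ℚ) ^ q) := by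
          gcongr
      _ = 2 * ((2 : ℚ) ^ q * (q.factorial : ℚ) * W *
          (((2 * (p₀ + 1) + k : ℕ) : ℚ) ^ q / ((p₀ + 1 : ℕ) : ℚ) ^ q)) := by ring
  have hGm : G m ≤ (2 : ℚ) ^ (m / 2) := key_of_two_base G m₀ hGstep h0 h1 m hm₀
  -- the cap in `ℚ`
  have hn1 : 1 ≤ n := by omega
  have hcap : ({X : Set α | X ⊆ M.E ∧ M.eRk X ≤ (q : ℕ∞)}.ncard : ℚ) ≤ W * (n : ℚ) ^ q := by
    have hc1 : ({X : Set α | X ⊆ M.E ∧ M.eRk X ≤ (q : ℕ∞)}.ncard : ℚ) ≤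
        ∑ j ∈ Finset.range (q + 1), (n.choose j : ℚ) * (w j : ℚ) := by
      rw [hn_def]
      exact_mod_cast hcount
    exact hc1.trans (sum_choose_mul_le_pow q n hn1 w)
  -- the `p`-side
  have hΦ := phiK_add_one_mul_choose_le p q
  have hCq : ((p + 1 : ℕ) : ℚ) ^ q ≤ ((p + q).choose p : ℚ) * (q.factorial : ℚ) := by
    exact_mod_cast pow_le_choose_mul_factorial p q
  have hΦnn : 0 ≤ phiK p q + 1 := by linarith [phiK_nonneg p q]
  have hp1 : (0 : ℚ) < ((p + 1 : ℕ) : ℚ) := by positivity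
  have hratio := div_le_of_ge p₀ p m hp
  have hR0 : 0 ≤ ((2 * (p₀ + 1) + m : ℕ) : ℚ) / ((p₀ + 1 : ℕ) : ℚ) := by positivity
  have hnq : (n : ℚ) ^ q = (((2 * p + m : ℕ) : ℚ) / ((p + 1 : ℕ) : ℚ)) ^ q * ((p + 1 : ℕ) : ℚ) ^ q := by
    rw [← mul_pow, div_mul_cancel₀ _ hp1.ne', hnm]
  have hhalf : n / 2 = p + m / 2 := by omega
  refine rls_of_hyperplane_key M p q hR hfree (W * (n : ℚ) ^ q) hcap ?_
  rw [hhalf, pow_add]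
  calc (phiK p q + 1) * (W * (n : ℚ) ^ q)
      = (phiK p q + 1) * (W * ((((2 * p + m : ℕ) : ℚ) / ((p + 1 : ℕ) : ℚ)) ^ q * ((p + 1 : ℕ) : ℚ) ^ q)) := by
        rw [hnq]
    _ ≤ (phiK p q + 1) * (W * ((((2 * (p₀ + 1) + m : ℕ) : ℚ) / ((p₀ + 1 : ℕ) : ℚ)) ^ q *
          ((p + 1 : ℕ) : ℚ) ^ q)) := by gcongr
    _ ≤ (phiK p q + 1) * (W * ((((2 * (p₀ + 1) + m : ℕ) : ℚ) / ((p₀ + 1 : ℕ) : ℚ)) ^ q *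
          (((p + q).choose p : ℚ) * (q.factorial : ℚ)))) := by gcongr
    _ = ((phiK p q + 1) * ((p + q).choose p : ℚ)) *
          (W * (((2 * (p₀ + 1) + m : ℕ) : ℚ) / ((p₀ + 1 : ℕ) : ℚ)) ^ q * (q.factorial : ℚ)) := by ring
    _ ≤ (2 : ℚ) ^ (p + q) *
          (W * (((2 * (p₀ + 1) + m : ℕ) : ℚ) / ((p₀ + 1 : ℕ) : ℚ)) ^ q * (q.factorial : ℚ)) := by
        gcongr
    _ = (2 : ℚ) ^ p * G m := by
        simp only [hG]
        rw [pow_add]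
        ring
    _ ≤ (2 : ℚ) ^ p * (2 : ℚ) ^ (m / 2) := by gcongr

/-- **THE RANK-`≤ 5` COUNT, FLAT BY FLAT** (the level-`6` weights restricted to `j ≤ 5`: `g = 1, 2, 4, 8, 32, 99`). -/
theorem ncard_eRk_le_five_le_of_free_flats (M : Matroid α) [M.Finite]
    (hfree : ∀ e ∈ M.E, ∃ A ⊆ M.E \ {e}, e ∉ M.closure A ∧ e ∉ M.closure ((M.E \ {e}) \ A)) :
    {X : Set α | X ⊆ M.E ∧ M.eRk X ≤ ((5 : ℕ) : ℕ∞)}.ncard ≤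
      ∑ j ∈ Finset.range (5 + 1), M.E.ncard.choose j * (fun j : ℕ => if j = 0 then 1 else if j = 1 then 2 else if j = 2 then 4 else if j = 3 then 8 else if j = 4 then 32 else if j = 5 then 99 else 387624) j :=
  ncard_eRk_le_le_sum_choose_flats M 5 (fun j : ℕ => if j ≤ 2 then 2 ^ j - 1 else if j = 3 then 6 else if j = 4 then 10 else if j = 5 then 19 else 39) (fun j : ℕ => if j = 0 then 1 else if j = 1 then 2 else if j = 2 then 4 else if j = 3 then 8 else if j = 4 then 32 else if j = 5 then 99 else 387624)
    (fun j hj => flat_six_of_free' M hfree j (by omega)) (fun j hj => flat_six_weights j (by omega))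

/-- **Level `5`, every row at once**: `e`-free, `ρ(E) = p ≥ 8`, `n ≥ 2p + 62` give `RLS M p 5`. -/
theorem c025_core_five_hyperplane_key_uniform (M : Matroid α) [M.Finite] (p : ℕ) (hp : 8 ≤ p)
    (hR : M.eRank = (p : ℕ∞)) (hn : 2 * p + 62 ≤ M.E.ncard)
    (hfree : ∀ e ∈ M.E, ∃ A ⊆ M.E \ {e}, e ∉ M.closure A ∧ e ∉ M.closure ((M.E \ {e}) \ A)) :
    ThmN.RLS M p 5 :=
  rls_of_hyperplane_key_uniform_weighted M p 5 hR hfree (fun j : ℕ => if j = 0 then 1 else if j = 1 then 2 else if j = 2 then 4 else if j = 3 then 8 else if j = 4 then 32 else if j = 5 then 99 else 387624)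
    (ncard_eRk_le_five_le_of_free_flats M hfree) (by norm_num) 8 62 hp (by norm_num) hn
    (by simp only [Finset.sum_range_succ, Finset.sum_range_zero]; norm_num [Nat.factorial])
    (by simp only [Finset.sum_range_succ, Finset.sum_range_zero]; norm_num [Nat.factorial])

/-- **Level `6`, every row at once**: `e`-free, `ρ(E) = p ≥ 9`, `n ≥ 2p + 92` give `RLS M p 6` (the per-row keys
`c025_core_six_hyperplane_key_sharp_<p>` hold from `102 … 120` at `p = 9 … 21`; this theorem from `110 … 134` there and for
every `p ≥ 22`). -/
theorem c025_core_six_hyperplane_key_uniform (M : Matroid α) [M.Finite] (p : ℕ) (hp : 9 ≤ p)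
    (hR : M.eRank = (p : ℕ∞)) (hn : 2 * p + 92 ≤ M.E.ncard)
    (hfree : ∀ e ∈ M.E, ∃ A ⊆ M.E \ {e}, e ∉ M.closure A ∧ e ∉ M.closure ((M.E \ {e}) \ A)) :
    ThmN.RLS M p 6 :=
  rls_of_hyperplane_key_uniform_weighted M p 6 hR hfree (fun j : ℕ => if j = 0 then 1 else if j = 1 then 2 else if j = 2 then 4 else if j = 3 then 8 else if j = 4 then 32 else if j = 5 then 99 else 387624)
    (ncard_eRk_le_six_le_of_free_flats M hfree) (by norm_num) 9 92 hp (by norm_num) hn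
    (by simp only [Finset.sum_range_succ, Finset.sum_range_zero]; norm_num [Nat.factorial])
    (by simp only [Finset.sum_range_succ, Finset.sum_range_zero]; norm_num [Nat.factorial])

/-- **Level `7`, every row at once**: `e`-free, `ρ(E) = p ≥ 10`, `n ≥ 2p + 170` give `RLS M p 7` — the large-corank tail of
EVERY row `p ≥ 10` of level `7` (the per-row keys `c025_core_seven_hyperplane_key_sharp_<p>` hold from `182 … 196` at
`p = 10 … 21`; this theorem from `190 … 212` there, `378` at `p = 104`, `2p + 170` everywhere). -/
theorem c025_core_seven_hyperplane_key_uniform (M : Matroid α) [M.Finite] (p : ℕ) (hp : 10 ≤ p)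
    (hR : M.eRank = (p : ℕ∞)) (hn : 2 * p + 170 ≤ M.E.ncard)
    (hfree : ∀ e ∈ M.E, ∃ A ⊆ M.E \ {e}, e ∉ M.closure A ∧ e ∉ M.closure ((M.E \ {e}) \ A)) :
    ThmN.RLS M p 7 :=
  rls_of_hyperplane_key_uniform_weighted M p 7 hR hfree (fun j : ℕ => if j = 0 then 1 else if j = 1 then 2 else if j = 2 then 4 else if j = 3 then 8 else if j = 4 then 32 else if j = 5 then 99 else if j = 6 then 387624 else 538123198718864)
    (ncard_eRk_le_seven_le_of_free_flats M hfree) (by norm_num) 10 170 hp (by norm_num) hn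
    (by simp only [Finset.sum_range_succ, Finset.sum_range_zero]; norm_num [Nat.factorial])
    (by simp only [Finset.sum_range_succ, Finset.sum_range_zero]; norm_num [Nat.factorial])

end HypKey

end PercRepro
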